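import Summits.QuantumFields.YangMills.Theorems.BalabanUVNodesN15KingModelTorusFreeDeterminant
import Summits.QuantumFields.YangMills.Theorems.BalabanUVNodesN15KingModelEffectiveLaplacianContinuumLimit
import Summits.QuantumFields.YangMills.Theorems.BalabanUVNodesN15KingModelFineFieldGeneratingFunctional
import HarnessLib

/-!
# BalabanUVNodes ∕ N15 — THE KING-MODEL RUNG (PART Ε-n): THE RG BLOCK-FIELD DETERMINANT IN CLOSED FORM —
# `det Δ^{(K)} = Π_{q∈Ω̂} effSym(q)` on every unit torus (King's (2.6)∕(3.89) Gaussian normalisation `ln N_K = −½ ln det Δ^{(K)}`, the determinant half, by plane waves),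
# through a GENERIC LEMMA: a real matrix with entries `|Ω|⁻¹Σ_q σ(q)·Re e^{iq·(b′−b)}` and EVEN symbol `σ` has determinant `Π_q σ(q)`
# (Track A, DAG node N15 = NE2; FAN-OUT v1.1 §N15 s3 «KING-MODEL RUNG»; companion of Ε-k for the BLOCK field; count-neutral)

HONEST FRAMING.  Count-neutral (cell `pub-ymgap`, seat `pub-ymgap-dag-n15-e` g40; `--supports stmt-QuantumFields-27366 --as helper` = K3⁸).
TEMPLATE LITERATURE: C. King, Commun. Math. Phys. **102** (1986) 649–677 [King1986], (2.6) p.652 (`N_k = ∫ exp(−½⟨ψ,Δ^{(k)}ψ⟩)`), (2.14) p.653 (`Δ^{(k)}`), (3.89)–(3.93) pp.668–669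
(the normalisations of the effective actions; (3.93): their `η`-rate `CL^{−2k}·#sites`), (4.5) p.670 (the plane-wave symbol of `Δ^{(k)}`), (4.35) p.674.  The tree HAS
the plane-wave ENTRY formula of `Δ^{(K)}` (part Ϡ-f `effLaplacian_apply_eq_fourier`: `Δ^{(K)}(b,b′) = |Ω|⁻¹Σ_q effSym(q)·Re e^{iq·(b′−b)}`) but no determinant: the lineage's
normalisations were typed determinant-free (part Τ-b).  THIS FILE: §1 EVENNESS on the dual torus — `lapSym(−p) = lapSym(p)` (`lapSym_torNeg`, via `ZMod.natAbs_valMinAbs_neg`),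
`u(−p) = conj u(p)` (`u_neg`, `norm_u_neg`), `red(−p) = −red(p)`, hence ★ `Sfib_neg` (King's alias sum `S(q)` of (4.5) is even) and ★ `effSym_neg`; §2 ★★ **`det_eq_prod_of_evenSymbol`**
— GENERIC: if `A(b,b′) = |Ω|⁻¹Σ_q σ(q)Re e^{iq·(b′−b)}` with `σ(−q) = σ(q)`, then `A = |Ω|⁻¹·Φ·diag(σ)·Φᴴ` over ℂ (Ε-k's plane-wave matrix `Φ`; the sum `Σ_qσ(q)e^{iq·w}` is REAL for
even `σ`) and `det A = Π_q σ(q)` (`ΦᴴΦ = |Ω|·1`); §3 ★★★ **`det_effLaplacian_eq_prod_effSym`**: `det(effLaplacian N M a c m²) = Π_q effSym(q)` for `a, c ≥ 0`, `m² > 0`, every `N ≥ 1` and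
every unit torus; ★★ **`log_det_effLaplacian`** (`= Σ_q log effSym(q)`, `a > 0`), ★★ **`log_det_effLaplacian_bounds`** (`|Ω|·log(a∕(1 + a∕m²)) ≤ log det Δ^{(K)} ≤ |Ω|·log a` —
extensive, uniform in `N` and the volume: `a∕(1+a∕m²) ≤ effSym ≤ a` from `0 ≤ S(q) ≤ 1∕m²`).

PRIOR TREE ART (used, not restated): `King1986.EffectiveLaplacianSymbol` (`effLaplacian`, `effSym`, `Sfib`, `effSym_eq_inv`, `Sfib_nonneg`, `lapSym`), `King1986.TorusBlockForm`
(`u`, `red`, `fib`, `chi_mul_conj_chi`, `chi_neg_left`), `B5Prop11Plancherel` (`chi`, `conj_chi`, `sOf`), part Ϡ-f `effLaplacian_apply_eq_fourier`, part Ϝ-c `Sfib_le_inv_mass`,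
part Ε-k (`kingWaveMatrix`, `conjTranspose_kingWaveMatrix_mul`, `det_kingWaveMatrix_ne_zero`).  NOT Bałaban's covariant objects; NOT a node discharge (N15 is booked through
n15-a's knit, untouched); nothing continuum-YM ∕ `ℝ⁴` ∕ OS ∕ Clay.  0 `sorry`, 0 `def`.

HONEST SCOPE.  Finite-dimensional linear algebra on every unit torus `Π_μℤ∕M_μ` (dimension written `d+1`), `N ≥ 1` fine points per block side, `a, c ≥ 0`, `m² > 0`; the
identification `ln N_K = ½|Ω|log(2π) − ½ log det Δ^{(K)}` (Gaussian integral) and the `η`-rate (3.93) of `log det Δ^{(K)}` (from part Ϡ-g's symbol rate) are doors.  Locators: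
[King1986] (2.6) p.652, (2.14) p.653, (3.89)–(3.93) pp.668–669, (4.5) p.670, (4.35) p.674.
-/

noncomputable section

open scoped BigOperators ComplexConjugate
open Finset Complex Matrix

namespace Summit.QuantumFields.YangMills.BalabanUVNodes.N15KingModelRung.TorusSpectral

open Literature.MathematicalPhysics.QuantumFieldTheory.Balaban1983to89.B5Prop11Plancherel (Tor fine chi sOf conj_chi sum_chi)
open Literature.MathematicalPhysics.QuantumFieldTheory.King1986.Torus

variable {d : ℕ}

/-! ## §1 Evenness on the dual torus -/

section Even

/-- `lapSym(−p) = lapSym(p)` (the symbol depends on `cos p′_μ` only, and `|valMinAbs(−x)| = |valMinAbs(x)|`). [cite: King1986, (4.4) p.670] -/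
theorem lapSym_torNeg {n : ℕ} (K : Fin n → ℕ) [∀ μ, NeZero (K μ)] (c m2 : ℝ) (p : Tor K) : lapSym K c m2 (-p) = lapSym K c m2 p := by
  unfold lapSym
  congr 1
  congr 1
  refine Finset.sum_congr rfl fun μ _ => ?_
  have habs : |((-p) μ).valMinAbs| = |(p μ).valMinAbs| := by
    have h := ZMod.natAbs_valMinAbs_neg (p μ)
    rw [Pi.neg_apply, ← Int.natCast_natAbs, ← Int.natCast_natAbs, h]
  have hcos : Real.cos (sOf K (-p) μ) = Real.cos (sOf K p μ) := by
    have e : ∀ v : ℤ, Real.cos (2 * Real.pi * (v : ℝ) / (K μ : ℝ)) = Real.cos (2 * Real.pi * ((|v| : ℤ) : ℝ) / (K μ : ℝ)) := fun v => by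
      rcases abs_choice v with h | h
      · rw [h]
      · rw [h, Int.cast_neg, show 2 * Real.pi * -(v : ℝ) / (K μ : ℝ) = -(2 * Real.pi * (v : ℝ) / (K μ : ℝ)) by ring, Real.cos_neg]
    simp only [sOf]
    rw [e, e (p μ).valMinAbs, habs]
  rw [hcos]

variable (N : ℕ) [NeZero N] (M : Fin (d + 1) → ℕ) [hM : ∀ μ, NeZero (M μ)]

/-- `u(−p) = conj u(p)` (King's alias weight is the Fourier coefficient of a real block indicator). [cite: King1986, (4.3) p.670] -/
theorem u_neg (p : Tor (fine N M)) : u N M (-p) = conj (u N M p) := by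
  unfold u
  rw [map_mul, map_sum]
  congr 1
  · rw [map_inv₀, map_pow, Complex.conj_natCast]
  · exact Finset.sum_congr rfl fun j _ => (conj_chi (fine N M) p _).symm

/-- `|u(−p)| = |u(p)|`. [cite: King1986, (4.3) p.670] -/
theorem norm_u_neg (p : Tor (fine N M)) : ‖u N M (-p)‖ = ‖u N M p‖ := by rw [u_neg, Complex.norm_conj]

omit [NeZero N] hM in
/-- the reduction commutes with negation: `red(−p) = −red(p)`. [folklore] -/
theorem red_neg (p : Tor (fine N M)) : red N M (-p) = -red N M p := by
  funext μ; simp [red]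

/-- ★ KING's ALIAS SUM IS EVEN: `S(−q) = S(q)`. [cite: King1986, (4.5) p.670] -/
theorem Sfib_neg (c m2 : ℝ) (q : Tor M) : Sfib N M c m2 (-q) = Sfib N M c m2 q := by
  unfold Sfib
  rw [Finset.sum_filter, Finset.sum_filter]
  rw [← Fintype.sum_equiv (Equiv.neg (Tor (fine N M))) (fun p => if red N M (-p) = -q then ‖u N M (-p)‖ ^ 2 / lapSym (fine N M) c m2 (-p) else 0)
    (fun p => if red N M p = -q then ‖u N M p‖ ^ 2 / lapSym (fine N M) c m2 p else 0) (fun p => rfl)]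
  refine Finset.sum_congr rfl fun p _ => ?_
  simp only [red_neg, neg_inj, norm_u_neg, lapSym_torNeg]

/-- ★ THE SYMBOL OF THE EFFECTIVE LAPLACIAN IS EVEN: `effSym(−q) = effSym(q)`. [cite: King1986, (4.5) p.670] -/
theorem effSym_neg (a c m2 : ℝ) (q : Tor M) : effSym N M a c m2 (-q) = effSym N M a c m2 q := by
  unfold effSym; rw [Sfib_neg]

end Even

/-! ## §2 Generic: even symbols give circulant determinants -/

section Generic

variable (M : Fin (d + 1) → ℕ) [hM : ∀ μ, NeZero (M μ)]

/-- for an EVEN real symbol the plane-wave sum `Σ_q σ(q)e^{iq·w}` is real: it equals `Σ_q σ(q)·Re e^{iq·w}`. [folklore] -/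
theorem sum_evenSymbol_chi_eq_re (σ : Tor M → ℝ) (hσ : ∀ q, σ (-q) = σ q) (w : Tor M) :
    ∑ q : Tor M, (σ q : ℂ) * chi M q w = ((∑ q : Tor M, σ q * (chi M q w).re : ℝ) : ℂ) := by
  set S : ℂ := ∑ q : Tor M, (σ q : ℂ) * chi M q w with hS
  have hconj : conj S = S := by
    rw [hS, map_sum]
    rw [← Fintype.sum_equiv (Equiv.neg (Tor M)) (fun q => conj ((σ (-q) : ℂ) * chi M (-q) w)) (fun q => conj ((σ q : ℂ) * chi M q w)) (fun q => rfl)]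
    refine Finset.sum_congr rfl fun q _ => ?_
    rw [map_mul, Complex.conj_ofReal, conj_chi, neg_neg, hσ]
  have hre : S = ((S.re : ℝ) : ℂ) := (Complex.conj_eq_iff_re.mp hconj).symm
  rw [hre]
  congr 1
  rw [hS, Complex.re_sum]
  exact Finset.sum_congr rfl fun q _ => by rw [Complex.re_ofReal_mul]

/-- for an even symbol, `Σ_q σ(q)e^{iq·(−w)} = Σ_q σ(q)e^{iq·w}`. [folklore] -/
theorem sum_evenSymbol_chi_neg (σ : Tor M → ℝ) (hσ : ∀ q, σ (-q) = σ q) (w : Tor M) :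
    ∑ q : Tor M, (σ q : ℂ) * chi M q (-w) = ∑ q : Tor M, (σ q : ℂ) * chi M q w := by
  rw [← Fintype.sum_equiv (Equiv.neg (Tor M)) (fun q => (σ (-q) : ℂ) * chi M (-q) (-w)) (fun q => (σ q : ℂ) * chi M q (-w)) (fun q => rfl)]
  exact Finset.sum_congr rfl fun q _ => by rw [hσ, Literature.MathematicalPhysics.QuantumFieldTheory.Balaban1983to89.B5Prop11Plancherel.chi_neg_neg]

/-- ★★ **GENERIC: EVEN SYMBOLS GIVE CIRCULANT DETERMINANTS.**  If a real matrix on the torus `Π_μℤ∕M_μ` has entries `A(b,b′) = |Ω|⁻¹Σ_q σ(q)·Re e^{iq·(b′−b)}` with an even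
symbol `σ`, then `A = |Ω|⁻¹ΦDΦᴴ` over ℂ (`Φ` the plane-wave matrix, `D = diag σ`) and `det A = Π_q σ(q)`. [cite: King1986, (4.35) p.674; Balaban1984PropagatorsI, (1.29) p.23] -/
theorem det_eq_prod_of_evenSymbol (A : Matrix (Tor M) (Tor M) ℝ) (σ : Tor M → ℝ) (hσ : ∀ q, σ (-q) = σ q)
    (hA : ∀ b b', A b b' = (Fintype.card (Tor M) : ℝ)⁻¹ * ∑ q : Tor M, σ q * (chi M q (b' - b)).re) :
    A.det = ∏ q : Tor M, σ q := by
  have hcard : (Fintype.card (Tor M) : ℂ) ≠ 0 := by exact_mod_cast Fintype.card_ne_zero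
  -- the matrix identity over ℂ
  have hmat : A.map ((↑) : ℝ → ℂ)
      = (Fintype.card (Tor M) : ℂ)⁻¹ • (kingWaveMatrix M * Matrix.diagonal (fun q => (σ q : ℂ)) * (kingWaveMatrix M)ᴴ) := by
    ext b b'
    have lhs : (A.map ((↑) : ℝ → ℂ)) b b' = (Fintype.card (Tor M) : ℂ)⁻¹ * ∑ q, (σ q : ℂ) * chi M q (b - b') := by
      rw [Matrix.map_apply, hA, Complex.ofReal_mul, Complex.ofReal_inv, Complex.ofReal_natCast, ← sum_evenSymbol_chi_eq_re M σ hσ,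
        show b' - b = -(b - b') by abel, sum_evenSymbol_chi_neg M σ hσ]
    have rhs : ((Fintype.card (Tor M) : ℂ)⁻¹ • (kingWaveMatrix M * Matrix.diagonal (fun q => (σ q : ℂ)) * (kingWaveMatrix M)ᴴ)) b b'
        = (Fintype.card (Tor M) : ℂ)⁻¹ * ∑ q, (σ q : ℂ) * chi M q (b - b') := by
      rw [Matrix.smul_apply, smul_eq_mul, Matrix.mul_apply]
      congr 1
      refine Finset.sum_congr rfl fun q _ => ?_
      simp only [Matrix.mul_diagonal, Matrix.conjTranspose_apply, kingWaveMatrix, Complex.star_def]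
      rw [mul_right_comm, chi_mul_conj_chi, mul_comm]
    rw [lhs, rhs]
  -- determinants
  have hΦΦ := congrArg Matrix.det (conjTranspose_kingWaveMatrix_mul M)
  rw [Matrix.det_mul, Matrix.det_smul, Matrix.det_one, mul_one] at hΦΦ
  have hdet := congrArg Matrix.det hmat
  rw [Matrix.det_smul, Matrix.det_mul, Matrix.det_mul, Matrix.det_diagonal] at hdet
  have hmap : ((A.det : ℝ) : ℂ) = (A.map ((↑) : ℝ → ℂ)).det := RingHom.map_det Complex.ofRealHom A
  have key : ((A.det : ℝ) : ℂ) = ∏ q : Tor M, (σ q : ℂ) := by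
    rw [hmap, hdet]
    calc (Fintype.card (Tor M) : ℂ)⁻¹ ^ Fintype.card (Tor M) * ((kingWaveMatrix M).det * (∏ q : Tor M, (σ q : ℂ)) * ((kingWaveMatrix M)ᴴ).det)
        = (∏ q : Tor M, (σ q : ℂ)) * ((Fintype.card (Tor M) : ℂ)⁻¹ ^ Fintype.card (Tor M) * (((kingWaveMatrix M)ᴴ).det * (kingWaveMatrix M).det)) := by ring
      _ = ∏ q : Tor M, (σ q : ℂ) := by rw [hΦΦ, ← mul_pow, inv_mul_cancel₀ hcard, one_pow, mul_one]
  exact_mod_cast key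

end Generic

/-! ## §3 The determinant of King's effective Laplacian -/

section BlockField

variable (N : ℕ) [NeZero N] (M : Fin (d + 1) → ℕ) [hM : ∀ μ, NeZero (M μ)] {a c m2 : ℝ}

/-- ★★★ **THE RG BLOCK-FIELD DETERMINANT IN CLOSED FORM**: `det(effLaplacian N M a c m²) = Π_{q∈Ω̂} effSym(q)` — the determinant of King's effective Laplacian `Δ^{(K)} = a − a²N^dQA₀⁻¹Qᵀ`
is the product of its plane-wave symbol `a∕(1 + aS(q))` over the dual torus (every `N ≥ 1`, `a, c ≥ 0`, `m² > 0`, every unit torus). [cite: King1986, (2.6) p.652, (2.14) p.653,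
(3.89) p.668, (4.5) p.670, (4.35) p.674] -/
theorem det_effLaplacian_eq_prod_effSym (ha : 0 ≤ a) (hc : 0 ≤ c) (hm : 0 < m2) :
    (effLaplacian N M a c m2).det = ∏ q : Tor M, effSym N M a c m2 q :=
  det_eq_prod_of_evenSymbol M _ _ (effSym_neg N M a c m2) (effLaplacian_apply_eq_fourier N M ha hc hm)

/-- the symbol is bounded: `a∕(1 + a∕m²) ≤ effSym(q) ≤ a` (`0 ≤ S(q) ≤ 1∕m²`). [cite: King1986, (4.5) p.670, (4.8) p.671] -/
theorem effSym_bounds (ha : 0 < a) (hc : 0 ≤ c) (hm : 0 < m2) (q : Tor M) :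
    a / (1 + a / m2) ≤ effSym N M a c m2 q ∧ effSym N M a c m2 q ≤ a := by
  have hS0 := Sfib_nonneg (N := N) (M := M) hc hm q
  have hS1 := Sfib_le_inv_mass (N := N) (M := M) hc hm q
  unfold effSym
  constructor
  · apply div_le_div_of_nonneg_left ha.le (by positivity)
    rw [div_eq_mul_inv]
    exact add_le_add le_rfl (mul_le_mul_of_nonneg_left hS1 ha.le)
  · calc a / (1 + a * Sfib N M c m2 q) ≤ a / 1 := div_le_div_of_nonneg_left ha.le one_pos (le_add_of_nonneg_right (mul_nonneg ha.le hS0))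
      _ = a := div_one a

/-- the symbol is positive (`a > 0`). [cite: King1986, (4.5) p.670] -/
theorem effSym_pos' (ha : 0 < a) (hc : 0 ≤ c) (hm : 0 < m2) (q : Tor M) : 0 < effSym N M a c m2 q :=
  lt_of_lt_of_le (by positivity) (effSym_bounds N M ha hc hm q).1

/-- ★★ `det Δ^{(K)} > 0` (`a > 0`). [cite: King1986, (2.6) p.652, (3.89) p.668] -/
theorem det_effLaplacian_pos (ha : 0 < a) (hc : 0 ≤ c) (hm : 0 < m2) : 0 < (effLaplacian N M a c m2).det := by
  rw [det_effLaplacian_eq_prod_effSym N M ha.le hc hm]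
  exact Finset.prod_pos fun q _ => effSym_pos' N M ha hc hm q

/-- ★★ **THE NORMALISATION AS A PLANE-WAVE SUM**: `log det Δ^{(K)} = Σ_{q∈Ω̂} log effSym(q)` (King's `−2 ln N_K` up to the `(2π)^{|Ω|∕2}` Lebesgue factor). [cite: King1986, (2.6) p.652,
(3.89) p.668, (4.5) p.670] -/
theorem log_det_effLaplacian (ha : 0 < a) (hc : 0 ≤ c) (hm : 0 < m2) :
    Real.log (effLaplacian N M a c m2).det = ∑ q : Tor M, Real.log (effSym N M a c m2 q) := by
  rw [det_effLaplacian_eq_prod_effSym N M ha.le hc hm, Real.log_prod]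
  exact fun q _ => (effSym_pos' N M ha hc hm q).ne'

/-- ★★ **EXTENSIVE BOUNDS, UNIFORM IN `N` AND THE VOLUME**: `|Ω|·log(a∕(1 + a∕m²)) ≤ log det Δ^{(K)} ≤ |Ω|·log a` (King's (3.93): `ln N` is `O(#sites)` uniformly in the
scale). [cite: King1986, (3.89)–(3.93) pp.668–669] -/
theorem log_det_effLaplacian_bounds (ha : 0 < a) (hc : 0 ≤ c) (hm : 0 < m2) :
    (Fintype.card (Tor M) : ℝ) * Real.log (a / (1 + a / m2)) ≤ Real.log (effLaplacian N M a c m2).det ∧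
      Real.log (effLaplacian N M a c m2).det ≤ (Fintype.card (Tor M) : ℝ) * Real.log a := by
  have hlo : 0 < a / (1 + a / m2) := by positivity
  rw [log_det_effLaplacian N M ha hc hm]
  constructor
  · calc (Fintype.card (Tor M) : ℝ) * Real.log (a / (1 + a / m2)) = ∑ _q : Tor M, Real.log (a / (1 + a / m2)) := by
          rw [Finset.sum_const, Finset.card_univ, nsmul_eq_mul]
      _ ≤ ∑ q : Tor M, Real.log (effSym N M a c m2 q) := Finset.sum_le_sum fun q _ => Real.log_le_log hlo (effSym_bounds N M ha hc hm q).1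
  · calc ∑ q : Tor M, Real.log (effSym N M a c m2 q) ≤ ∑ _q : Tor M, Real.log a :=
          Finset.sum_le_sum fun q _ => Real.log_le_log (effSym_pos' N M ha hc hm q) (effSym_bounds N M ha hc hm q).2
      _ = (Fintype.card (Tor M) : ℝ) * Real.log a := by rw [Finset.sum_const, Finset.card_univ, nsmul_eq_mul]

end BlockField

end Summit.QuantumFields.YangMills.BalabanUVNodes.N15KingModelRung.TorusSpectral

end
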